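import Literature.MathematicalPhysics.StatisticalMechanics.HcpHomogeneous
import HarnessLib

/-!
# Site geometry of the hexagonal close packing: closer neighbours and the covering radius

Topic: `Literature/MathematicalPhysics/StatisticalMechanics`.  Elementary metric facts about the
point set `hcpStacking a h = {barlowPos a h alternatingHagg k i j}` of `BarlowStacking.lean`
(in-layer spacing `a`, layer spacing `h`, letters `ABAB…`):

* `hcp_dist_sq_eq`, `hcp_norm_sq_eq` — squared distances and norms of the sites as polynomials in
  the indices `(k, i, j)` and the layer letters `haggLabel alternatingHagg k ∈ {0, 1}` (no `√3`);
* `exists_closer_hcp_site` — **every site `s ≠ 0` has a neighbouring site strictly closer to the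
  origin**, quantitatively: some site `s'` with `dist s s'² ≤ max (a²) (a²/3 + h²)` and
  `‖s'‖² + min (a²) (h² − a²/3) ≤ ‖s‖²` (an in-layer unit step `±u, ±v, ±(u − v)`, or the step to
  the adjacent layer towards `0`; useful when `h² > a²/3`, e.g. the ideal `h² = 2a²/3`, where it
  drives inductions along decreasing norm through the stacking);
* `exists_hcp_site_near` — **crude covering radius**: every point of `ℝ³` is within
  `√(3a²/4 + h²)` of a site (already of an even layer `ℤu + ℤv + 2hℤ e₃`).

Not here: the exact covering radius, coordination shells (`BarlowCoordination.lean`).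

References: J. H. Conway, N. J. A. Sloane, *Sphere Packings, Lattices and Groups*, Ch. 1 §1.3;
T. C. Hales, *Dense Sphere Packings*, §1.3.  All statements are routine coordinate computations
([folklore]).
-/

noncomputable section

namespace Literature.MathematicalPhysics.StatisticalMechanics

section HcpSites

variable (a h : ℝ)

/-- **Squared distance of two hcp sites** as a polynomial in the indices and letters (the `√3`
of the layer coordinates eliminated). [folklore] -/
theorem hcp_dist_sq_eq (k i j k' i' j' : ℤ) :
    dist (barlowPos a h alternatingHagg k i j) (barlowPos a h alternatingHagg k' i' j') ^ 2 =
      a ^ 2 * (((i : ℝ) - i') ^ 2 + ((i : ℝ) - i') * ((j : ℝ) - j') + ((j : ℝ) - j') ^ 2 +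
        ((haggLabel alternatingHagg k : ℝ) - haggLabel alternatingHagg k') *
          (((i : ℝ) - i') + ((j : ℝ) - j')) +
        ((haggLabel alternatingHagg k : ℝ) - haggLabel alternatingHagg k') ^ 2 / 3) +
      ((k : ℝ) - k') ^ 2 * h ^ 2 := by
  rw [dist_barlowPos_sq]
  have h3 : (√3 : ℝ) ^ 2 = 3 := Real.sq_sqrt (by norm_num)
  linear_combination (a ^ 2 / 4 * (((j : ℝ) - j') +
    ((haggLabel alternatingHagg k : ℝ) - haggLabel alternatingHagg k') / 3) ^ 2) * h3

/-- The hcp letters are `0` or `1`. [folklore] -/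
theorem haggLabel_alternating_eq_zero_or_one (k : ℤ) :
    haggLabel alternatingHagg k = 0 ∨ haggLabel alternatingHagg k = 1 := by
  rw [haggLabel_alternating]; split_ifs <;> simp

/-- The origin is the hcp site `(0,0,0)`. [folklore] -/
theorem barlowPos_alternating_zero : barlowPos a h alternatingHagg 0 0 0 = 0 := by
  simp [barlowPos]

/-- **Squared norm of an hcp site** as a polynomial:
`‖(k,i,j)‖² = a² (i² + ij + j² + L (i + j) + L/3) + k² h²`, `L` the letter of layer `k`.
[folklore] -/
theorem hcp_norm_sq_eq (k i j : ℤ) :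
    ‖barlowPos a h alternatingHagg k i j‖ ^ 2 =
      a ^ 2 * ((i : ℝ) ^ 2 + (i : ℝ) * j + (j : ℝ) ^ 2 +
        (haggLabel alternatingHagg k : ℝ) * ((i : ℝ) + j) + (haggLabel alternatingHagg k : ℝ) / 3) +
      (k : ℝ) ^ 2 * h ^ 2 := by
  have hL : (haggLabel alternatingHagg k : ℝ) ^ 2 = haggLabel alternatingHagg k := by
    rcases haggLabel_alternating_eq_zero_or_one k with h0 | h0 <;> simp [h0]
  rw [← dist_zero_right, ← barlowPos_alternating_zero a h, hcp_dist_sq_eq]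
  simp only [haggLabel_zero, Int.cast_zero, sub_zero]
  linear_combination (a ^ 2 / 3) * hL

/-- **In-layer step**: a unit step `±u, ±v, ±(u − v)` inside layer `k` that lowers the in-layer
form `i² + ij + j² + L (i + j)` by at least `1` has length `a` and lowers `‖·‖²` by `≥ a²`.
[folklore] -/
theorem hcp_inLayer_step (k i j i' j' : ℤ)
    (hd : (i - i') ^ 2 + (i - i') * (j - j') + (j - j') ^ 2 = 1)
    (hdec : 1 ≤ (i ^ 2 + i * j + j ^ 2 + haggLabel alternatingHagg k * (i + j)) -
      (i' ^ 2 + i' * j' + j' ^ 2 + haggLabel alternatingHagg k * (i' + j'))) :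
    dist (barlowPos a h alternatingHagg k i j) (barlowPos a h alternatingHagg k i' j') ^ 2 = a ^ 2 ∧
      ‖barlowPos a h alternatingHagg k i' j'‖ ^ 2 + a ^ 2 ≤
        ‖barlowPos a h alternatingHagg k i j‖ ^ 2 := by
  have hd' : ((i : ℝ) - i') ^ 2 + ((i : ℝ) - i') * ((j : ℝ) - j') + ((j : ℝ) - j') ^ 2 = 1 := by
    exact_mod_cast hd
  have hdec' : (1 : ℝ) ≤
      ((i : ℝ) ^ 2 + i * j + (j : ℝ) ^ 2 + (haggLabel alternatingHagg k : ℝ) * (i + j)) -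
        ((i' : ℝ) ^ 2 + i' * j' + (j' : ℝ) ^ 2 +
          (haggLabel alternatingHagg k : ℝ) * (i' + j')) := by
    exact_mod_cast hdec
  constructor
  · rw [hcp_dist_sq_eq, sub_self, hd']
    ring
  · rw [hcp_norm_sq_eq, hcp_norm_sq_eq]
    nlinarith [sq_nonneg a]

/-- **Step from an even layer**: from the site `k h e₃` of an even layer `k` to the site
`w + k' h e₃` of an adjacent odd layer `k'` nearer to the origin: length² `a²/3 + h²`, and
`‖·‖²` drops by `≥ h² − a²/3`. [folklore] -/
theorem hcp_step_from_even_layer (k k' : ℤ) (hk : Even k) (hk' : Odd k')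
    (hkk : (k - k') ^ 2 = 1) (hlt : k' ^ 2 + 1 ≤ k ^ 2) :
    dist (barlowPos a h alternatingHagg k 0 0) (barlowPos a h alternatingHagg k' 0 0) ^ 2 =
        a ^ 2 / 3 + h ^ 2 ∧
      ‖barlowPos a h alternatingHagg k' 0 0‖ ^ 2 + (h ^ 2 - a ^ 2 / 3) ≤
        ‖barlowPos a h alternatingHagg k 0 0‖ ^ 2 := by
  have hL := haggLabel_alternating_of_even hk
  have hL' := haggLabel_alternating_of_odd hk'
  have hkk' : ((k : ℝ) - k') ^ 2 = 1 := by exact_mod_cast hkk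
  have hlt' : (k' : ℝ) ^ 2 + 1 ≤ (k : ℝ) ^ 2 := by exact_mod_cast hlt
  constructor
  · rw [hcp_dist_sq_eq, hL, hL', hkk']
    norm_num
    ring
  · rw [hcp_norm_sq_eq, hcp_norm_sq_eq, hL, hL']
    norm_num
    nlinarith [sq_nonneg h]

/-- **Step from an odd layer**: from a *central* site of an odd layer `k` (one of the three sites
with in-layer part of squared norm `a²/3`, i.e. `i² + ij + j² + i + j = 0`) to the site `k' h e₃`
of an adjacent even layer nearer to the origin: length² `a²/3 + h²`, and `‖·‖²` drops by
`≥ h² + a²/3`. [folklore] -/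
theorem hcp_step_from_odd_layer (k k' i j : ℤ) (hk : Odd k) (hk' : Even k')
    (hkk : (k - k') ^ 2 = 1) (hlt : k' ^ 2 + 1 ≤ k ^ 2)
    (hc : i ^ 2 + i * j + j ^ 2 + i + j = 0) :
    dist (barlowPos a h alternatingHagg k i j) (barlowPos a h alternatingHagg k' 0 0) ^ 2 =
        a ^ 2 / 3 + h ^ 2 ∧
      ‖barlowPos a h alternatingHagg k' 0 0‖ ^ 2 + (h ^ 2 + a ^ 2 / 3) ≤
        ‖barlowPos a h alternatingHagg k i j‖ ^ 2 := by
  have hL := haggLabel_alternating_of_odd hk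
  have hL' := haggLabel_alternating_of_even hk'
  have hkk' : ((k : ℝ) - k') ^ 2 = 1 := by exact_mod_cast hkk
  have hlt' : (k' : ℝ) ^ 2 + 1 ≤ (k : ℝ) ^ 2 := by exact_mod_cast hlt
  have hc' : (i : ℝ) ^ 2 + i * j + (j : ℝ) ^ 2 + i + j = 0 := by exact_mod_cast hc
  constructor
  · rw [hcp_dist_sq_eq, hL, hL', hkk']
    norm_num
    linear_combination a ^ 2 * hc'
  · rw [hcp_norm_sq_eq, hcp_norm_sq_eq, hL, hL']
    norm_num
    nlinarith [sq_nonneg h, sq_nonneg a]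

/-- **Every hcp site `s ≠ 0` has a neighbouring site closer to the origin**: some site `s'` with
`dist s s'² ≤ max (a²) (a²/3 + h²)` and `‖s'‖² + min (a²) (h² − a²/3) ≤ ‖s‖²`.  (Sites off the
layer axis through `0` — resp. off the three central sites of an odd layer — admit an in-layer unit
step lowering the in-layer form; the remaining sites step to the adjacent layer.)  No hypothesis
on `a, h`; the statement is useful when `h² > a²/3`. [folklore] -/
theorem exists_closer_hcp_site {s : EuclideanSpace ℝ (Fin 3)} (hs : s ∈ hcpStacking a h)
    (hs0 : s ≠ 0) :
    ∃ s' ∈ hcpStacking a h, dist s s' ^ 2 ≤ max (a ^ 2) (a ^ 2 / 3 + h ^ 2) ∧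
      ‖s'‖ ^ 2 + min (a ^ 2) (h ^ 2 - a ^ 2 / 3) ≤ ‖s‖ ^ 2 := by
  obtain ⟨k, i, j, rfl⟩ := hs
  -- packaging: a site `(k', i', j')` with the two estimates
  have site : ∀ k' i' j' : ℤ, ∀ d m : ℝ, d ≤ max (a ^ 2) (a ^ 2 / 3 + h ^ 2) →
      min (a ^ 2) (h ^ 2 - a ^ 2 / 3) ≤ m →
      (dist (barlowPos a h alternatingHagg k i j) (barlowPos a h alternatingHagg k' i' j') ^ 2 = d ∧
        ‖barlowPos a h alternatingHagg k' i' j'‖ ^ 2 + m ≤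
          ‖barlowPos a h alternatingHagg k i j‖ ^ 2) →
      ∃ s' ∈ hcpStacking a h, dist (barlowPos a h alternatingHagg k i j) s' ^ 2 ≤
          max (a ^ 2) (a ^ 2 / 3 + h ^ 2) ∧
        ‖s'‖ ^ 2 + min (a ^ 2) (h ^ 2 - a ^ 2 / 3) ≤ ‖barlowPos a h alternatingHagg k i j‖ ^ 2 :=
    fun k' i' j' d m hd hm hst => ⟨_, barlowPos_mem k' i' j', hst.1 ▸ hd, by linarith [hst.2]⟩
  have hmax1 : a ^ 2 ≤ max (a ^ 2) (a ^ 2 / 3 + h ^ 2) := le_max_left _ _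
  have hmax2 : a ^ 2 / 3 + h ^ 2 ≤ max (a ^ 2) (a ^ 2 / 3 + h ^ 2) := le_max_right _ _
  have hmin1 : min (a ^ 2) (h ^ 2 - a ^ 2 / 3) ≤ a ^ 2 := min_le_left _ _
  have hmin2 : min (a ^ 2) (h ^ 2 - a ^ 2 / 3) ≤ h ^ 2 - a ^ 2 / 3 := min_le_right _ _
  have hmin3 : min (a ^ 2) (h ^ 2 - a ^ 2 / 3) ≤ h ^ 2 + a ^ 2 / 3 := by nlinarith [sq_nonneg a]
  rcases Int.even_or_odd k with hk | hk
  · have hL : haggLabel alternatingHagg k = 0 := haggLabel_alternating_of_even hk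
    by_cases hij : i = 0 ∧ j = 0
    · obtain ⟨rfl, rfl⟩ := hij
      have hk0 : k ≠ 0 := by
        rintro rfl
        exact hs0 (barlowPos_alternating_zero a h)
      rcases lt_or_gt_of_ne hk0 with hneg | hpos
      · exact site (k + 1) 0 0 _ _ hmax2 hmin2 (hcp_step_from_even_layer a h k (k + 1) hk
          hk.add_one (by ring) (by nlinarith))
      · exact site (k - 1) 0 0 _ _ hmax2 hmin2 (hcp_step_from_even_layer a h k (k - 1) hk
          (hk.sub_odd odd_one) (by ring) (by nlinarith))
    · have h6 : 2 ≤ 2 * i + j ∨ 2 * i + j ≤ -2 ∨ 2 ≤ i + 2 * j ∨ i + 2 * j ≤ -2 ∨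
          2 ≤ i - j ∨ i - j ≤ -2 := by omega
      rcases h6 with h1 | h1 | h1 | h1 | h1 | h1
      · exact site k (i - 1) j _ _ hmax1 hmin1 (hcp_inLayer_step a h k i j (i - 1) j (by ring)
          (by rw [hL]; nlinarith))
      · exact site k (i + 1) j _ _ hmax1 hmin1 (hcp_inLayer_step a h k i j (i + 1) j (by ring)
          (by rw [hL]; nlinarith))
      · exact site k i (j - 1) _ _ hmax1 hmin1 (hcp_inLayer_step a h k i j i (j - 1) (by ring)
          (by rw [hL]; nlinarith))
      · exact site k i (j + 1) _ _ hmax1 hmin1 (hcp_inLayer_step a h k i j i (j + 1) (by ring)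
          (by rw [hL]; nlinarith))
      · exact site k (i - 1) (j + 1) _ _ hmax1 hmin1 (hcp_inLayer_step a h k i j (i - 1) (j + 1)
          (by ring) (by rw [hL]; nlinarith))
      · exact site k (i + 1) (j - 1) _ _ hmax1 hmin1 (hcp_inLayer_step a h k i j (i + 1) (j - 1)
          (by ring) (by rw [hL]; nlinarith))
  · have hL : haggLabel alternatingHagg k = 1 := haggLabel_alternating_of_odd hk
    by_cases hc : (i = 0 ∧ j = 0) ∨ (i = -1 ∧ j = 0) ∨ (i = 0 ∧ j = -1)
    · have hc' : i ^ 2 + i * j + j ^ 2 + i + j = 0 := by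
        rcases hc with ⟨rfl, rfl⟩ | ⟨rfl, rfl⟩ | ⟨rfl, rfl⟩ <;> norm_num
      rcases lt_or_ge k 0 with hneg | hpos
      · exact site (k + 1) 0 0 _ _ hmax2 hmin3 (hcp_step_from_odd_layer a h k (k + 1) i j hk
          hk.add_one (by ring) (by nlinarith) hc')
      · have hk1 : 1 ≤ k := by
          rcases hk with ⟨m, rfl⟩
          omega
        exact site (k - 1) 0 0 _ _ hmax2 hmin3 (hcp_step_from_odd_layer a h k (k - 1) i j hk
          (hk.sub_odd odd_one) (by ring) (by nlinarith) hc')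
    · have h6 : 1 ≤ 2 * i + j ∨ 2 * i + j ≤ -3 ∨ 1 ≤ i + 2 * j ∨ i + 2 * j ≤ -3 ∨
          2 ≤ i - j ∨ i - j ≤ -2 := by omega
      rcases h6 with h1 | h1 | h1 | h1 | h1 | h1
      · exact site k (i - 1) j _ _ hmax1 hmin1 (hcp_inLayer_step a h k i j (i - 1) j (by ring)
          (by rw [hL]; nlinarith))
      · exact site k (i + 1) j _ _ hmax1 hmin1 (hcp_inLayer_step a h k i j (i + 1) j (by ring)
          (by rw [hL]; nlinarith))
      · exact site k i (j - 1) _ _ hmax1 hmin1 (hcp_inLayer_step a h k i j i (j - 1) (by ring)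
          (by rw [hL]; nlinarith))
      · exact site k i (j + 1) _ _ hmax1 hmin1 (hcp_inLayer_step a h k i j i (j + 1) (by ring)
          (by rw [hL]; nlinarith))
      · exact site k (i - 1) (j + 1) _ _ hmax1 hmin1 (hcp_inLayer_step a h k i j (i - 1) (j + 1)
          (by ring) (by rw [hL]; nlinarith))
      · exact site k (i + 1) (j - 1) _ _ hmax1 hmin1 (hcp_inLayer_step a h k i j (i + 1) (j - 1)
          (by ring) (by rw [hL]; nlinarith))

/-- `x² ≤ 1/4` for a rounding error `x = t − round t`. [folklore] -/
theorem sq_sub_round_le_quarter (x : ℝ) : (x - round x) ^ 2 ≤ 1 / 4 := by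
  have h1 := abs_sub_round x
  have h2 : (x - round x) ^ 2 = |x - round x| ^ 2 := (sq_abs _).symm
  rw [h2]
  nlinarith [abs_nonneg (x - round x)]

variable {a h}

/-- **Crude covering radius of hcp**: every point of `ℝ³` is within `√(3a²/4 + h²)` of a site
(`a, h ≠ 0`).  The even layers `ℤu + ℤv + 2hℤ e₃` suffice: round the height to the nearest even
layer (error `≤ |h|`) and the in-layer coordinates w.r.t. `u, v` to the nearest integers (error
`x u + y v`, `|x|, |y| ≤ 1/2`, of squared norm `a² (x² + xy + y²) ≤ 3a²/4`). [folklore] -/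
theorem exists_hcp_site_near (ha : a ≠ 0) (hh : h ≠ 0) (z : EuclideanSpace ℝ (Fin 3)) :
    ∃ s ∈ hcpStacking a h, dist z s ^ 2 ≤ 3 / 4 * a ^ 2 + h ^ 2 := by
  obtain ⟨β, hβ⟩ : ∃ β : ℝ, β = z 1 / (a * √3 / 2) := ⟨_, rfl⟩
  obtain ⟨α, hα⟩ : ∃ α : ℝ, α = z 0 / a - β / 2 := ⟨_, rfl⟩
  obtain ⟨t, ht⟩ : ∃ t : ℝ, t = z 2 / (2 * h) := ⟨_, rfl⟩
  refine ⟨barlowPos a h alternatingHagg (2 * round t) (round α) (round β), barlowPos_mem _ _ _, ?_⟩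
  have hL : haggLabel alternatingHagg (2 * round t) = 0 :=
    haggLabel_alternating_of_even (even_two_mul _)
  have h3 : (√3 : ℝ) ^ 2 = 3 := Real.sq_sqrt (by norm_num)
  have h3pos : (√3 : ℝ) ≠ 0 := by positivity
  have hz0 : z 0 = a * (α + β / 2) := by rw [hα]; field_simp; ring
  have hz1 : z 1 = a * √3 / 2 * β := by rw [hβ]; field_simp
  have hz2 : z 2 = 2 * h * t := by rw [ht]; field_simp
  have hsq : dist z (barlowPos a h alternatingHagg (2 * round t) (round α) (round β)) ^ 2 =
      a ^ 2 * ((α - round α) ^ 2 + (α - round α) * (β - round β) + (β - round β) ^ 2) +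
        4 * h ^ 2 * (t - round t) ^ 2 := by
    rw [EuclideanSpace.dist_sq_eq, Fin.sum_univ_three, Real.dist_eq,
      Real.dist_eq, Real.dist_eq, sq_abs, sq_abs, sq_abs, barlowPos_apply_zero,
      barlowPos_apply_one, barlowPos_apply_two, hL]
    rw [hz0, hz1, hz2]
    push_cast
    linear_combination (a ^ 2 / 4 * (β - round β) ^ 2) * h3
  have hx := sq_sub_round_le_quarter α
  have hy := sq_sub_round_le_quarter β
  have htt := sq_sub_round_le_quarter t
  have hform : (α - round α) ^ 2 + (α - round α) * (β - round β) + (β - round β) ^ 2 ≤ 3 / 4 := by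
    nlinarith [sq_nonneg ((α - round α) - (β - round β))]
  rw [hsq]
  nlinarith [sq_nonneg a, sq_nonneg h,
    mul_nonneg (sq_nonneg a) (show (0 : ℝ) ≤ 3 / 4 - _ from sub_nonneg.2 hform)]

end HcpSites

end Literature.MathematicalPhysics.StatisticalMechanics

end
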